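/-
Origin: expansion seat `planner-pub-hodgecm-toy2-g3-0`, handover #6 2026-08-18T06:58:16Z (`HOME/pub-hodgecm-toy2-g3/lean/Toy2g3/TruncAlgExt.lean`, md5 6090ffab, 350 lines);
landed by the gen-7 packager in gate run 25 as `HodgeCM/Model/Toy/TruncAlgExt.lean` (import ^import Toy2g3\.(TruncAlgMilne|TruncAlgAtExt|TruncAlgAt|TruncAlgDual|TruncAlgCM|TruncAlgExt)\b→import HodgeCM.Model.Toy.\1 ×1).
-/
/-
Copyright: pub-hodgecm formalisation cell (harness21, 2026). New file (not vendored).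
Origin: HOME/pub-hodgecm-toy2-g3/lean/Toy2g3/TruncAlgExt.lean — session planner-pub-hodgecm-toy2-g3-0 (unit pub-hodgecm-toy2-g3,
CONSISTENCY seat 2, part (6a)(ii), generation 3).  WIP module `Toy2g3.TruncAlgExt`; intended final place
`HodgeCM/Model/Toy/TruncAlgExt.lean` (module `HodgeCM.Model.Toy.TruncAlgExt`; kind L5 consistency / non-vacuity layer).
WIP import to rewrite on landing: `import Toy2g3.TruncAlgDual` ↦ `import HodgeCM.Model.Toy.TruncAlgDual` (this seat, HANDOVER #4).
-/
import Summits.HodgeConjecture.HodgeCM.Model.Toy.TruncAlgDual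

/-!
# [QW8] Thm 2.5 step (ii) `Qw8ExtProd` FAILS under truncation: the complete truncation profile

`TruncAlgMilne` / `TruncAlgDual` decided four of the five obligations of `qw8Sufficiency_of_steps'` in the codimension-two
truncation `truncModel`; the remaining one, step (ii) `Qw8ExtProd` ("characters of algebraic weight vectors are closed
under addition"), is decided here: it FAILS, for a counting reason made precise by a SIGN FUNCTIONAL on the value group
`Asym F` of the Lefschetz character.

* `sgnChar P₁ P₂ P₃ : Asym F →ₗ[ℤ] ℤ` sends a basic character `ā[Ψ]` to the product of the three membership signs
  `±1` of `P₁, P₂, P₃ ∈ Ψ` (odd under `Ψ ↦ Ψ̄`, so it kills the pair relations); hence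
  `|sgnChar (a(e_S))| ≤ Σ_j |S_j|` (`abs_sgnChar_lefChar_le`), and `Σ_j |S_j| = 2·codim` for every nonzero weight vector
  (`WVec.sum_card_eq`, M + N1 + N3).
* For a face `f = (Φ; π, π')`, a base point `σ₀` and a third place `ρ ∌ π, π'` (`exists_third_place`, `[F:ℚ] ≥ 6`), the
  functional attached to the translates of `p, p', r` takes the SAME value `±1` on the four corner characters
  `ā[Φ_i^{(σ₀)}]` (`typeSign_corner`: each corner differs from `Φ` by an even number of sign changes among
  `p ∈ ·, p' ∈ ·, r ∈ ·`), so `|sgnChar (a(e_f))| = 4` for the Weil generator `e_f` of weight `(i ↦ {σ₀})`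
  (`exists_signFunctional_face`).
* `not_qw8ExtProd_truncAlg (M) (N1) (N3) (W_RK4) : ¬ U.truncAlg.Qw8ExtProd`: the Weil generator `v = e_f` is algebraic of
  codimension `2` (the PROVED bridge `qw8FaceBridge_holds` + `W_RK4`), so `v` is algebraic in the truncation; an algebraic
  `z` of the truncation with `a(z) = a(v) + a(v)` would have codimension `≤ 2`, i.e. `|sgnChar (a(z))| ≤ 4 < 8`.
* `qw8ExtProd_of_descent_all`: step (ii) in ALL degrees from M, N1, N3, F4, F5, F7d, `Fact_dimProd` (positive degrees:
  qw8-g4's `qw8ExtProdPos_of_descent`; degree `0`: character `0`).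

Toy (`truncModel = toyModel.truncAlg`): `toyModel_qw8ExtProd`, `not_truncModel_qw8ExtProd`, and the COMPLETE PROFILE
`truncModel_qw8Profile`: steps (i) `Qw8Conj` ✓, (iii)+(v) `Qw8DualPushPull` ✓, (iv)₀ `Qw8MilneZero` ✓, bridge ✓ SURVIVE
the truncation, and exactly the two ADDITIVE steps — (ii) `Qw8ExtProd` ✗ and Milne's (iv) `Qw8Milne` ✗ — FAIL; all six hold
in `toyModel` (`toyModel_qw8Steps_all`).  Hence `qw8ExtProd_independent`, `not_qw8ExtProd_of_other_steps`.
All proofs kernel-checked; no cited facts.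
-/

noncomputable section

open scoped TensorProduct

namespace HodgeCM

open Literature.AlgebraicGeometry.Motives (CMType)
open CMTypeOps NumberField NumberField.ComplexEmbedding
open HodgeCM.Prior.AllgGroup.RfwfAllgGroup

/-! ## 1. The sign functional on `Asym F` -/

section SignFunctional

variable {F : Type} [Field F] [NumberField F]

attribute [local instance] Classical.propDecidable

/-- The product of the three membership signs of `P₁, P₂, P₃` in a group-level CM type `Ψ`. -/
def sgn3 (P₁ P₂ P₃ : GalT F) (Ψ : CMF (GalT F) conjT) : ℤ :=
  (if P₁ ∈ Ψ.1 then 1 else -1) * (if P₂ ∈ Ψ.1 then 1 else -1) * (if P₃ ∈ Ψ.1 then 1 else -1)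

/-- (Ported verbatim from the HodgeCMPerL package; no docstring in the source.) -/
theorem sgn3_barCM (P₁ P₂ P₃ : GalT F) (Ψ : CMF (GalT F) conjT) :
    sgn3 P₁ P₂ P₃ (barCM Ψ) = - sgn3 P₁ P₂ P₃ Ψ := by
  unfold sgn3
  simp only [mem_barCM]
  by_cases h1 : P₁ ∈ Ψ.1 <;> by_cases h2 : P₂ ∈ Ψ.1 <;> by_cases h3 : P₃ ∈ Ψ.1 <;> simp [h1, h2, h3]

/-- (Ported verbatim from the HodgeCMPerL package; no docstring in the source.) -/
theorem abs_sgn3 (P₁ P₂ P₃ : GalT F) (Ψ : CMF (GalT F) conjT) : |sgn3 P₁ P₂ P₃ Ψ| = 1 := by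
  unfold sgn3
  by_cases h1 : P₁ ∈ Ψ.1 <;> by_cases h2 : P₂ ∈ Ψ.1 <;> by_cases h3 : P₃ ∈ Ψ.1 <;> simp [h1, h2, h3]

/-- The sign functional on `ℤ[types]`. -/
def sgnFun (P₁ P₂ P₃ : GalT F) : (CMF (GalT F) conjT →₀ ℤ) →ₗ[ℤ] ℤ :=
  Finsupp.linearCombination ℤ (sgn3 P₁ P₂ P₃)

/-- (Ported verbatim from the HodgeCMPerL package; no docstring in the source.) -/
theorem sgnFun_single (P₁ P₂ P₃ : GalT F) (Ψ : CMF (GalT F) conjT) (c : ℤ) :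
    sgnFun P₁ P₂ P₃ (Finsupp.single Ψ c) = c * sgn3 P₁ P₂ P₃ Ψ := by
  simp [sgnFun]

/-- (Ported verbatim from the HodgeCMPerL package; no docstring in the source.) -/
theorem pairRel_le_ker_sgnFun (P₁ P₂ P₃ : GalT F) : pairRel ≤ LinearMap.ker (sgnFun P₁ P₂ P₃) := by
  refine Submodule.span_le.mpr ?_
  rintro _ ⟨Ψ, rfl⟩
  simp only [SetLike.mem_coe, LinearMap.mem_ker, map_add, sgnFun_single, sgn3_barCM, one_mul, add_neg_cancel]

/-- **The sign functional** `Asym F → ℤ`, `ā[Ψ] ↦ ∏_{k ≤ 3} (±1)^{[P_k ∉ Ψ]}` (it kills the pairs `[Ψ] + [Ψ̄]`). -/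
def sgnChar (P₁ P₂ P₃ : GalT F) : Asym F →ₗ[ℤ] ℤ :=
  (pairRel (F := F)).liftQ (sgnFun P₁ P₂ P₃) (pairRel_le_ker_sgnFun P₁ P₂ P₃)

/-- (Ported verbatim from the HodgeCMPerL package; no docstring in the source.) -/
theorem sgnChar_achar (P₁ P₂ P₃ : GalT F) (Ψ : CMF (GalT F) conjT) :
    sgnChar P₁ P₂ P₃ (achar Ψ) = sgn3 P₁ P₂ P₃ Ψ := by
  change sgnFun P₁ P₂ P₃ (Finsupp.single Ψ 1) = _
  rw [sgnFun_single, one_mul]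

/-- `|sgnChar (a(e_S))| ≤ Σ_j |S_j|`. -/
theorem abs_sgnChar_lefChar_le (P₁ P₂ P₃ : GalT F) {n : ℕ} (Θ : Fin (n + 1) → CMType F)
    (S : Fin (n + 1) → Finset (F →+* ℂ)) :
    |sgnChar P₁ P₂ P₃ (lefChar Θ S)| ≤ ∑ j, ((S j).card : ℤ) := by
  unfold lefChar
  rw [map_sum]
  refine (Finset.abs_sum_le_sum_abs _ _).trans (Finset.sum_le_sum fun j _ => ?_)
  rw [map_sum]
  refine (Finset.abs_sum_le_sum_abs _ _).trans ?_
  rw [Finset.card_eq_sum_ones, Nat.cast_sum]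
  refine Finset.sum_le_sum fun s _ => ?_
  rw [sgnChar_achar, abs_sgn3, Nat.cast_one]

end SignFunctional

/-! ## 2. The sign of a CM type at three embeddings; the corners of a face -/

section TypeSign

variable {K : Type} [Field K]

attribute [local instance] Classical.propDecidable

/-- `τ(X) = (±1)(±1)(±1)`, the membership signs of `p, p', r` in the CM type `X`. -/
def typeSign (p p' r : K →+* ℂ) (X : CMType K) : ℤ :=
  (if p ∈ X.1 then 1 else -1) * (if p' ∈ X.1 then 1 else -1) * (if r ∈ X.1 then 1 else -1)

/-- (Ported verbatim from the HodgeCMPerL package; no docstring in the source.) -/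
theorem abs_typeSign (p p' r : K →+* ℂ) (X : CMType K) : |typeSign p p' r X| = 1 := by
  unfold typeSign
  by_cases h1 : p ∈ X.1 <;> by_cases h2 : p' ∈ X.1 <;> by_cases h3 : r ∈ X.1 <;> simp [h1, h2, h3]

/-- (Ported verbatim from the HodgeCMPerL package; no docstring in the source.) -/
theorem typeSign_bar (p p' r : K →+* ℂ) (X : CMType K) : typeSign p p' r (bar X) = - typeSign p p' r X := by
  unfold typeSign
  simp only [mem_bar_iff]
  by_cases h1 : p ∈ X.1 <;> by_cases h2 : p' ∈ X.1 <;> by_cases h3 : r ∈ X.1 <;> simp [h1, h2, h3]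

/-- (Ported verbatim from the HodgeCMPerL package; no docstring in the source.) -/
theorem mem_placeSet_self (p : K →+* ℂ) : p ∈ placeSet p := by simp [placeSet]

/-- (Ported verbatim from the HodgeCMPerL package; no docstring in the source.) -/
theorem notMem_placeSet_of_mk_ne {p q : K →+* ℂ} (h : InfinitePlace.mk q ≠ InfinitePlace.mk p) : q ∉ placeSet p := by
  intro hq
  simp only [placeSet, Set.mem_insert_iff, Set.mem_singleton_iff] at hq
  rcases hq with rfl | rfl
  · exact h rfl
  · exact h (InfinitePlace.mk_conjugate_eq p)

/-- Flipping at the place of `p` changes exactly the first sign (if `p', r` lie at other places). -/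
theorem typeSign_flip_left {p p' r : K →+* ℂ} (hp' : p' ∉ placeSet p) (hr : r ∉ placeSet p) (X : CMType K) :
    typeSign p p' r (flip p X) = - typeSign p p' r X := by
  unfold typeSign
  have e1 : p ∈ (flip p X).1 ↔ p ∉ X.1 := by
    rw [mem_flip_iff]; have := mem_placeSet_self p; tauto
  have e2 : p' ∈ (flip p X).1 ↔ p' ∈ X.1 := by rw [mem_flip_iff]; tauto
  have e3 : r ∈ (flip p X).1 ↔ r ∈ X.1 := by rw [mem_flip_iff]; tauto
  simp only [e1, e2, e3]
  by_cases h1 : p ∈ X.1 <;> by_cases h2 : p' ∈ X.1 <;> by_cases h3 : r ∈ X.1 <;> simp [h1, h2, h3]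

/-- Flipping at the place of `p'` changes exactly the second sign. -/
theorem typeSign_flip_mid {p p' r : K →+* ℂ} (hp : p ∉ placeSet p') (hr : r ∉ placeSet p') (X : CMType K) :
    typeSign p p' r (flip p' X) = - typeSign p p' r X := by
  unfold typeSign
  have e1 : p ∈ (flip p' X).1 ↔ p ∈ X.1 := by rw [mem_flip_iff]; tauto
  have e2 : p' ∈ (flip p' X).1 ↔ p' ∉ X.1 := by
    rw [mem_flip_iff]; have := mem_placeSet_self p'; tauto
  have e3 : r ∈ (flip p' X).1 ↔ r ∈ X.1 := by rw [mem_flip_iff]; tauto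
  simp only [e1, e2, e3]
  by_cases h1 : p ∈ X.1 <;> by_cases h2 : p' ∈ X.1 <;> by_cases h3 : r ∈ X.1 <;> simp [h1, h2, h3]

/-- **The four corners of a face have the same sign** at `(p, p', r)`, `r` at a third place: each corner differs from
`Φ` by an even number of the operations `bar`, `flip p`, `flip p'`. -/
theorem typeSign_corner (f : Face K) {r : K →+* ℂ} (hr : InfinitePlace.mk r ≠ InfinitePlace.mk f.p)
    (hr' : InfinitePlace.mk r ≠ InfinitePlace.mk f.p') (i : Fin 4) :
    typeSign f.p f.p' r (f.corner i) = typeSign f.p f.p' r f.Φ := by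
  have hpp' : f.p' ∉ placeSet f.p := notMem_placeSet_of_mk_ne f.place_ne.symm
  have hp'p : f.p ∉ placeSet f.p' := notMem_placeSet_of_mk_ne f.place_ne
  have hrp : r ∉ placeSet f.p := notMem_placeSet_of_mk_ne hr
  have hrp' : r ∉ placeSet f.p' := notMem_placeSet_of_mk_ne hr'
  fin_cases i
  · rfl
  · show typeSign f.p f.p' r (flip f.p (bar f.Φ)) = _
    rw [typeSign_flip_left hpp' hrp, typeSign_bar, neg_neg]
  · show typeSign f.p f.p' r (flip f.p' (bar f.Φ)) = _
    rw [typeSign_flip_mid hp'p hrp', typeSign_bar, neg_neg]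
  · show typeSign f.p f.p' r (flip f.p' (flip f.p f.Φ)) = _
    rw [typeSign_flip_mid hp'p hrp', typeSign_flip_left hpp' hrp, neg_neg]

end TypeSign

/-! ## 3. The sign functional of a face: `|Λ(a(e_f))| = 4` -/

section FaceFunctional

attribute [local instance] Classical.propDecidable

/-- A CM field of degree `≥ 6` has a third infinite place. -/
theorem exists_third_place (F : CMField) (h6 : 6 ≤ Module.finrank ℚ F) (p p' : (F : Type) →+* ℂ) :
    ∃ r : (F : Type) →+* ℂ, InfinitePlace.mk r ≠ InfinitePlace.mk p ∧ InfinitePlace.mk r ≠ InfinitePlace.mk p' := by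
  have hcard : 2 < (Finset.univ : Finset (InfinitePlace F)).card := by
    rw [Finset.card_univ]
    have h1 := InfinitePlace.card_eq_nrRealPlaces_add_nrComplexPlaces (K := F)
    have h2 := IsTotallyComplex.finrank (K := F)
    have h3 := IsTotallyComplex.nrRealPlaces_eq_zero (K := F)
    omega
  obtain ⟨w, -, hw⟩ := Finset.exists_mem_notMem_of_card_lt_card
    (s := ({InfinitePlace.mk p, InfinitePlace.mk p'} : Finset (InfinitePlace F))) (t := Finset.univ)
    (lt_of_le_of_lt Finset.card_le_two hcard)
  refine ⟨w.embedding, ?_, ?_⟩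
  · rw [InfinitePlace.mk_embedding]; intro h; exact hw (by simp [h])
  · rw [InfinitePlace.mk_embedding]; intro h; exact hw (by simp [h])

/-- Read through the base point `σ₀`, the sign functional at the translates of `p, p', r` is `typeSign p p' r`. -/
theorem sgn3_pullType (F : CMField) [IsGalois ℚ F] (σ₀ p p' r : (F : Type) →+* ℂ) (X : CMType F) :
    sgn3 (translate σ₀ p) (translate σ₀ p') (translate σ₀ r) (pullType X σ₀) = typeSign p p' r X := by
  unfold sgn3 typeSign
  simp only [mem_pullType, translate_apply_self]

/-- **The character of a Weil generator has sign-norm four**: for a face `f` of a Galois CM field of degree `≥ 6` and a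
base point `σ₀` there is an additive functional `Λ : Asym F → ℤ` with `|Λ(a(e_S))| ≤ Σ_j |S_j|` for every weight and
`|Λ(a_f)| = 4` for `a_f = Σ_{i<4} ā[Φ_i^{(σ₀)}]`, the character of the weight `(i ↦ {σ₀})` on `P(f) = ∏_i A_{Φ_i}`. -/
theorem exists_signFunctional_face (F : CMField) [IsGalois ℚ F] (h6 : 6 ≤ Module.finrank ℚ F) (f : Face F)
    (σ₀ : (F : Type) →+* ℂ) :
    ∃ Λ : Asym F →ₗ[ℤ] ℤ,
      (∀ {n : ℕ} (Θ : Fin (n + 1) → CMType F) (S : Fin (n + 1) → Finset ((F : Type) →+* ℂ)),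
          |Λ (lefChar Θ S)| ≤ ∑ j, ((S j).card : ℤ)) ∧
        |Λ (lefChar f.corner (fun _ => ({σ₀} : Finset ((F : Type) →+* ℂ))))| = 4 := by
  obtain ⟨r, hr, hr'⟩ := exists_third_place F h6 f.p f.p'
  refine ⟨sgnChar (translate σ₀ f.p) (translate σ₀ f.p') (translate σ₀ r), fun Θ S => abs_sgnChar_lefChar_le _ _ _ Θ S,
    ?_⟩
  unfold lefChar
  simp only [Finset.sum_singleton, map_sum, sgnChar_achar, sgn3_pullType, typeSign_corner f hr hr',
    Finset.sum_const, Finset.card_univ, Fintype.card_fin]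
  rw [nsmul_eq_mul, abs_mul, abs_typeSign]
  norm_num

end FaceFunctional

namespace Universe

variable {U : Universe}

/-! ## 4. Every nonzero weight vector has `Σ_j |S_j| = 2 · codim` -/

/-- (Ported verbatim from the HodgeCMPerL package; no docstring in the source.) -/
theorem WVec.sum_card_eq {F : CMField} (M : U.ModelAxioms) (hN1 : U.Fact_cupExterior) (hN3 : U.Fact_pull_H0)
    (z : U.WVec F) : (∑ j, (z.S j).card) = 2 * z.p := by
  rcases Nat.eq_zero_or_pos z.p with hp | hp
  · rw [hp, mul_zero]
    exact Finset.sum_eq_zero fun j _ => by rw [WVec.S_eq_empty_of_p_eq_zero M hN3 z hp j, Finset.card_empty]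
  · by_contra hne
    obtain ⟨n, Θ, p, S, x, hx0, hxw⟩ := z
    change 0 < p at hp
    change ¬ (∑ j, (S j).card) = 2 * p at hne
    have hmem : x ∈ U.weightSpace F Θ S (2 * p) := (mem_weightSpace_iff _ _ _ _ _).mpr hxw
    rw [weightSpace_eq_bot_of_sum_card_ne M hN1 (by omega) hne, Submodule.mem_bot] at hmem
    exact hx0 hmem

/-! ## 5. Step (ii) in all degrees; step (ii) FAILS under truncation -/

/-- **[QW8] Thm 2.5 (ii) in ALL degrees** from M, N1, N3, F4, F5, F7d, `Fact_dimProd` (positive degrees: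
`qw8ExtProdPos_of_descent`; a degree-`0` factor has character `0` and is dropped). -/
theorem qw8ExtProd_of_descent_all (M : U.ModelAxioms) (hN1 : U.Fact_cupExterior) (hN3 : U.Fact_pull_H0)
    (h4 : U.Fact_cupAlg) (h5 : U.Fact_cupAssoc) (h7d : U.Fact_gysinDescent) (hd : U.Fact_dimProd) : U.Qw8ExtProd := by
  intro F hG h6 v w hv hw
  by_cases hvp : v.p = 0
  · exact ⟨w, hw, by rw [WVec.achar_eq_zero_of_p_eq_zero M hN3 v hvp, zero_add]⟩
  by_cases hwp : w.p = 0
  · exact ⟨v, hv, by rw [WVec.achar_eq_zero_of_p_eq_zero M hN3 w hwp, add_zero]⟩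
  obtain ⟨z, hz, -, hza⟩ := U.qw8ExtProdPos_of_descent M hN1 h4 h5 h7d hd F hG h6 v w hv hw (Nat.pos_of_ne_zero hvp)
    (Nat.pos_of_ne_zero hwp)
  exact ⟨z, hz, hza⟩

set_option smartUnfolding false in
/-- **`Qw8ExtProd` FAILS in `U.truncAlg`** (for `U` with `ModelAxioms`, N1, N3, `W_RK4`): the Weil generator `e_f` of a face
of `ℚ(ζ₇)` is an algebraic weight vector of codimension `2` (bridge + `W_RK4`), its character has sign-norm `4`, so
`a(e_f) + a(e_f)` has sign-norm `8`, while every algebraic weight vector of the truncation has codimension `≤ 2`, hence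
sign-norm `≤ 4`. -/
theorem not_qw8ExtProd_truncAlg (M : U.ModelAxioms) (hN1 : U.Fact_cupExterior) (hN3 : U.Fact_pull_H0) (hW : U.W_RK4) :
    ¬ U.truncAlg.Qw8ExtProd := by
  intro hE
  obtain ⟨F, hG, h6, f, -⟩ := HodgeCM.faceHypothesesInhabited
  haveI := hG
  obtain ⟨x, hx0, hxw, hxalg⟩ := U.qw8FaceBridge_holds M F hG h6 f (hW F hG h6 f) f.p
  let v : U.WVec F := ⟨3, f.corner, 2, fun _ => {f.p}, x, hx0, hxw⟩
  have hv : v.toTruncAlg.IsAlg := (WVec.isAlg_toTruncAlg_iff v le_rfl).mpr hxalg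
  obtain ⟨z, hz, hza⟩ := hE F hG h6 v.toTruncAlg v.toTruncAlg hv hv
  have hzp : z.p ≤ 2 := by
    by_contra h
    exact WVec.not_isAlg_truncAlg z (by omega) hz
  obtain ⟨Λ, hΛ, hΛf⟩ := exists_signFunctional_face F h6 f f.p
  have hcard := WVec.sum_card_eq M hN1 hN3 (WVec.ofTruncAlg z)
  change (∑ j, (z.S j).card) = 2 * z.p at hcard
  have h1 : |Λ z.achar| ≤ 2 * (z.p : ℤ) := by
    have h := hΛ z.Θ z.S
    have hc : (∑ j, ((z.S j).card : ℤ)) = ((2 * z.p : ℕ) : ℤ) := by rw [← hcard]; push_cast; rfl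
    rw [hc] at h
    exact_mod_cast h
  have h2 : Λ z.achar = 2 * Λ (lefChar f.corner (fun _ => ({f.p} : Finset ((F : Type) →+* ℂ)))) := by
    rw [hza]
    change Λ (lefChar f.corner (fun _ => ({f.p} : Finset ((F : Type) →+* ℂ))) +
      lefChar f.corner (fun _ => ({f.p} : Finset ((F : Type) →+* ℂ)))) = _
    rw [map_add, two_mul]
  rw [h2, abs_mul, hΛf] at h1
  norm_num at h1
  omega

end Universe

/-! ## 6. The toy instances: the complete truncation profile of [QW8] Thm 2.5 -/

namespace Toy

open Universe

/-- **[QW8] (ii) in ALL degrees in the exterior toy model.** -/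
theorem toyModel_qw8ExtProd : toyModel.Qw8ExtProd :=
  toyModel.qw8ExtProd_of_descent_all toyModel_modelAxioms toyModel_fact_cupExterior toyModel_fact_pull_H0 fact_cupAlg
    (fact_cupAssoc exteriorHodgeData) toyModel_fact_gysinDescent toyModel_fact_dimProd

/-- **[QW8] (ii) FAILS in `truncModel`.** -/
theorem not_truncModel_qw8ExtProd : ¬ truncModel.Qw8ExtProd :=
  toyModel.not_qw8ExtProd_truncAlg toyModel_modelAxioms toyModel_fact_cupExterior toyModel_fact_pull_H0 toyModel_w_rk4

/-- All six [QW8] obligations hold in `toyModel` (all degrees). -/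
theorem toyModel_qw8Steps_all :
    toyModel.Qw8Conj ∧ toyModel.Qw8ExtProd ∧ toyModel.Qw8DualPushPull ∧ toyModel.Qw8Milne ∧ toyModel.Qw8MilneZero ∧
      toyModel.Qw8FaceBridge :=
  ⟨toyModel.qw8Conj_holds, toyModel_qw8ExtProd, toyModel_qw8DualPushPull, toyModel_qw8Milne_of_descent,
    toyModel_qw8MilneZero, qw8FaceBridge_holds toyModel_modelAxioms⟩

/-- **The complete truncation profile of [QW8] Thm 2.5**: in `truncModel` steps (i), (iii)+(v), (iv)₀ and the bridge
HOLD, and exactly the two additive steps (ii) `Qw8ExtProd` and (iv) `Qw8Milne` FAIL. -/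
theorem truncModel_qw8Profile :
    (truncModel.Qw8Conj ∧ truncModel.Qw8DualPushPull ∧ truncModel.Qw8MilneZero ∧ truncModel.Qw8FaceBridge) ∧
      (¬ truncModel.Qw8ExtProd ∧ ¬ truncModel.Qw8Milne) :=
  ⟨⟨truncModel_qw8Conj, truncModel_qw8DualPushPull, truncModel_qw8MilneZero, truncModel_qw8FaceBridge⟩,
    ⟨not_truncModel_qw8ExtProd, not_truncModel_qw8Milne⟩⟩

/-- **`Qw8ExtProd` is independent** of `ModelAxioms ∧ PohlmannSpan ∧ PohlmannBasis ∧ W_RK4` together with the other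
surviving [QW8] steps. -/
theorem qw8ExtProd_independent :
    (∃ U : Universe, U.ModelAxioms ∧ U.PohlmannSpan ∧ U.PohlmannBasis ∧ U.W_RK4 ∧ U.Qw8ExtProd) ∧
      (∃ U : Universe, U.ModelAxioms ∧ U.PohlmannSpan ∧ U.PohlmannBasis ∧ U.W_RK4 ∧ U.Qw8Conj ∧ U.Qw8DualPushPull ∧
        U.Qw8MilneZero ∧ U.Qw8FaceBridge ∧ ¬ U.Qw8ExtProd) :=
  ⟨⟨toyModel, toyModel_modelAxioms, toyModel_pohlmannSpan', toyModel_pohlmannBasis', toyModel_w_rk4, toyModel_qw8ExtProd⟩,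
    ⟨truncModel, truncModel_modelAxioms, truncModel_pohlmannSpan, truncModel_pohlmannBasis, truncModel_w_rk4,
      truncModel_qw8Conj, truncModel_qw8DualPushPull, truncModel_qw8MilneZero, truncModel_qw8FaceBridge,
      not_truncModel_qw8ExtProd⟩⟩

/-- (Ported verbatim from the HodgeCMPerL package; no docstring in the source.) -/
theorem not_qw8ExtProd_of_other_steps :
    ¬ ∀ U : Universe, U.ModelAxioms → U.PohlmannSpan → U.PohlmannBasis → U.W_RK4 → U.Qw8Conj → U.Qw8DualPushPull →
      U.Qw8MilneZero → U.Qw8FaceBridge → U.Qw8ExtProd :=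
  fun h => not_truncModel_qw8ExtProd (h truncModel truncModel_modelAxioms truncModel_pohlmannSpan truncModel_pohlmannBasis
    truncModel_w_rk4 truncModel_qw8Conj truncModel_qw8DualPushPull truncModel_qw8MilneZero truncModel_qw8FaceBridge)

end Toy

end HodgeCM

end
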